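import Summits.Ventures.PercRepro.RankLevelSetDepCountSplit

/-!
# PercRepro — THE `U`-COUNT WITH MULTIPLICITY, PART A: the exact-size fibre, the union over the sizes, `B ⊆ cl(U)`
(night-1, gen 4; feeder lemmas for the sub-claims S2 / S3, RULING (ug))

`proofs/NIGHT-1-C025-induction.md` §15.17: `ncard_fibre_eq_le` (`#{B : U ⊆ B ⊆ F, |B| = m} ≤ C(|F ∖ U|, m − |U|)`),
`ncard_eRk_eq_ncard_le_le_sum` (`#{B : r(B) = q, |B| ≤ d} ≤ C(n, q) + Σ_{m=q+1}^{d} #{B : r(B) = q, |B| = m}`) and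
`subset_closure_of_eRk_eq` (a set `B ⊇ U` of the same rank lies in `cl(U)`). Axioms: standard.
-/

open scoped Matroid

namespace PercRepro

namespace Matroid

open Set

variable {α : Type} {M : _root_.Matroid α}

/-- The fibre of exact size: `#{B : U ⊆ B ⊆ F, |B| = m} ≤ C(m', m − u)` when `|U| = u` and `|F ∖ U| ≤ m'`. -/
theorem ncard_fibre_eq_le {U F : Set α} (hF : F.Finite) {u m' : ℕ} (hU : U.ncard = u)
    (hFU : (F \ U).ncard ≤ m') (m : ℕ) :
    {B : Set α | U ⊆ B ∧ B ⊆ F ∧ B.ncard = m}.ncard ≤ Nat.choose m' (m - u) := by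
  classical
  have hFUfin : (F \ U).Finite := hF.subset sdiff_subset
  set T := hFUfin.toFinset with hT
  have hTcoe : (T : Set α) = F \ U := Set.Finite.coe_toFinset _
  have hTcard : T.card ≤ m' := by
    rw [← Set.ncard_eq_toFinset_card _ hFUfin]; exact hFU
  have hmaps : ∀ B ∈ {B : Set α | U ⊆ B ∧ B ⊆ F ∧ B.ncard = m},
      B \ U ∈ {Z : Set α | Z ⊆ (T : Set α) ∧ Z.ncard = m - u} := by
    intro B hB
    have hBfin : B.Finite := hF.subset hB.2.1
    refine ⟨by rw [hTcoe]; exact sdiff_subset_sdiff_left hB.2.1, ?_⟩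
    rw [ncard_sdiff hB.1 (hBfin.subset hB.1), hU, hB.2.2]
  have hinj : InjOn (fun B => B \ U) {B : Set α | U ⊆ B ∧ B ⊆ F ∧ B.ncard = m} := by
    intro B hB B' hB' h
    simp only at h
    rw [← union_sdiff_cancel hB.1, h, union_sdiff_cancel hB'.1]
  calc {B : Set α | U ⊆ B ∧ B ⊆ F ∧ B.ncard = m}.ncard
      ≤ {Z : Set α | Z ⊆ (T : Set α) ∧ Z.ncard = m - u}.ncard :=
        ncard_le_ncard_of_injOn (fun B => B \ U) hmaps hinj
          ((T.finite_toSet.finite_subsets).subset (fun Z hZ => hZ.1))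
    _ = T.card.choose (m - u) := ncard_subsets_ncard_eq T (m - u)
    _ ≤ Nat.choose m' (m - u) := Nat.choose_le_choose _ hTcard

/-- **Union over the sizes**: `#{B : r(B) = q, |B| ≤ d} ≤ C(n, q) + Σ_{m = q+1}^{d} #{B : r(B) = q, |B| = m}`. -/
theorem ncard_eRk_eq_ncard_le_le_sum (M : _root_.Matroid α) [M.Finite] (q d : ℕ) :
    {B : Set α | B ⊆ M.E ∧ M.eRk B = q ∧ B.ncard ≤ d}.ncard ≤
      M.E.ncard.choose q +
        ∑ m ∈ Finset.Icc (q + 1) d, {B : Set α | B ⊆ M.E ∧ M.eRk B = q ∧ B.ncard = m}.ncard := by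
  classical
  set Ef := M.ground_finite.toFinset with hEf
  have hE : (Ef : Set α) = M.E := Set.Finite.coe_toFinset _
  have hEcard : Ef.card = M.E.ncard := (Set.ncard_eq_toFinset_card _ M.ground_finite).symm
  set S := {B : Set α | B ⊆ M.E ∧ M.eRk B = q ∧ B.ncard ≤ d} with hS
  set S₁ := {B : Set α | B ⊆ (Ef : Set α) ∧ B.ncard = q} with hS₁
  set U : ℕ → Set (Set α) := fun m => {B : Set α | B ⊆ M.E ∧ M.eRk B = q ∧ B.ncard = m} with hU
  have hUfin : ∀ m, (U m).Finite := fun m => M.ground_finite.finite_subsets.subset (fun B hB => hB.1)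
  have hS₁fin : S₁.Finite := (Ef.finite_toSet.finite_subsets).subset (fun B hB => hB.1)
  have hS₁ : S₁.ncard = M.E.ncard.choose q := by
    rw [hS₁, ncard_subsets_ncard_eq Ef q, hEcard]
  set T : Finset (Set α) := (Finset.Icc (q + 1) d).biUnion (fun m => (hUfin m).toFinset) with hT
  have hsplit : S ⊆ S₁ ∪ (T : Set (Set α)) := by
    intro B hB
    have hBfin : B.Finite := M.ground_finite.subset hB.1
    have hle : q ≤ B.ncard := by
      have := M.eRk_le_encard B
      rw [hB.2.1, ← hBfin.cast_ncard_eq] at this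
      exact_mod_cast this
    rcases hle.lt_or_eq with h | h
    · refine Or.inr ?_
      rw [Finset.mem_coe, hT, Finset.mem_biUnion]
      refine ⟨B.ncard, ?_, ?_⟩
      · rw [Finset.mem_Icc]; exact ⟨h, hB.2.2⟩
      · rw [Set.Finite.mem_toFinset]; exact ⟨hB.1, hB.2.1, rfl⟩
    · exact Or.inl ⟨by rw [hE]; exact hB.1, h.symm⟩
  calc S.ncard ≤ (S₁ ∪ (T : Set (Set α))).ncard := ncard_le_ncard hsplit (hS₁fin.union T.finite_toSet)
    _ ≤ S₁.ncard + (T : Set (Set α)).ncard := ncard_union_le _ _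
    _ ≤ M.E.ncard.choose q + ∑ m ∈ Finset.Icc (q + 1) d, (U m).ncard := by
        rw [hS₁, Set.ncard_coe_finset]
        gcongr
        calc T.card ≤ ∑ m ∈ Finset.Icc (q + 1) d, ((hUfin m).toFinset).card := Finset.card_biUnion_le
          _ = ∑ m ∈ Finset.Icc (q + 1) d, (U m).ncard := by
              apply Finset.sum_congr rfl
              intro m _
              exact (Set.ncard_eq_toFinset_card _ (hUfin m)).symm

/-- A set `B ⊇ U` of the same rank as `U` lies in `cl(U)`. -/
theorem subset_closure_of_eRk_eq {U B : Set α} (hUB : U ⊆ B) (hBE : B ⊆ M.E) {q : ℕ}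
    (hU : M.eRk U = q) (hB : M.eRk B = q) : B ⊆ M.closure U := by
  intro x hxB
  by_contra hnot
  have h1 : M.eRk (insert x U) = M.eRk U + 1 :=
    _root_.Matroid.eRk_insert_eq_add_one ⟨hBE hxB, hnot⟩
  have h2 : M.eRk (insert x U) ≤ M.eRk B := M.eRk_mono (insert_subset hxB hUB)
  rw [h1, hU, hB] at h2
  have h3 : (q : ℕ∞) + 1 ≤ (q : ℕ∞) := h2
  have h4 : q + 1 ≤ q := by exact_mod_cast h3
  omega

end Matroid

end PercRepro
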